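import Literature.AlgebraicGeometry.Resolution.MarkedIdeals
import Literature.AlgebraicGeometry.Resolution.BirationalStalkStructureMap
import Literature.AlgebraicGeometry.Morphisms.CechH1
import Mathlib.RingTheory.LocalRing.Length
import Mathlib.RingTheory.Localization.AtPrime.Basic
import Mathlib.RingTheory.Localization.Ideal
import HarnessLib

/-!
# Local colengths: `ℓ(Γ(U, 𝒪_X)/𝓙(U)) = ℓ(𝒪_{X,w}/𝓙_w)` for an ideal sheaf supported at one point of an
# affine open, and Fulton's `ℓ_A(M) = [κ(B):κ(A)] · ℓ_B(M)` (Lemma A.1.3) at the stalk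

Topic: `Literature/AlgebraicGeometry/Resolution`.  PROVED, fact-free, definition-free.  Third step of the
`χ = h⁰` calculus of J. Lipman, *Rational singularities …*, Publ. Math. IHÉS 36 (1969), §10 (p. 212: "the cohomology
modules of any coherent `𝒪_C`-module are of finite length over `A`; it makes sense therefore to talk about `h⁰(ℱ)`")
and §13 (proof of Prop. (13.1) d), p. 223), after `Resolution/RationalResolutionH0InclusionExclusion`
(`h⁰(𝒪/(𝓐∩𝓑)) + h⁰(𝒪/(𝓐+𝓑)) = h⁰(𝒪/𝓐) + h⁰(𝒪/𝓑)`) and `Resolution/H0ZeroDimensionalSubscheme`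
(`h⁰(𝒪/𝓙) = Σ_w ℓ_T(Γ(U_w, 𝒪)/𝓙(U_w))` for `𝓙` supported at finitely many closed points): the summand at `w`
is a LOCAL quantity,

  `ℓ_T(Γ(U, 𝒪_X)/𝓙(U)) = ℓ_T(𝒪_{X,w}/𝓙_w) = [κ(w) : κ(𝔪)] · ℓ_{𝒪_{X,w}}(𝒪_{X,w}/𝓙_w)`

(W. Fulton, *Intersection Theory*, App. A.1: Lemma A.1.2 — a finite-length module supported at `𝔭` is its own
localisation at `𝔭` — and Lemma A.1.3, `ℓ_A(M) = d · ℓ_B(M)` for a local homomorphism of local rings with residue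
degree `d`, Mathlib `IsLocalRing.length_restrictScalars`).

* §1 `quotientMap_localization_bijective`, `length_quotient_eq_length_quotient_map` — algebra: for `R → R_𝔭` and an
  ideal `J` modulo which every element outside `𝔭` is a unit, `R/J → R_𝔭/JR_𝔭` is bijective;
* §2 `isUnit_quotient_mk_of_support_inter_eq` — if `𝓙` meets the affine open `U` only at `w`, functions not vanishing
  at `w` are units modulo `𝓙(U)`; **`length_quotient_sections_eq_length_quotient_stalk`** —
  `ℓ_T(Γ(U, 𝒪)/𝓙(U)) = ℓ_T(𝒪_{X,w}/𝓙_w)` (`𝒪_{X,w}` a `T`-algebra through `T → Γ(X, 𝒪_X) → 𝒪_{X,w}`);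
* §3 (local base `T`, `w` over the closed point; `T → 𝒪_{X,w}` is local, tree `isLocalHom_germ_algebraMapΓ`) `length_quotient_stalk_eq_mul`,
  **`length_quotient_sections_eq_mul`** — `ℓ_T(Γ(U, 𝒪)/𝓙(U)) = ℓ_{𝒪_{X,w}}(𝒪_{X,w}/𝓙_w) · ℓ_{κ(𝔪)}(κ(w))`.

What remains for Lipman's `(F·E) = h⁰(𝒪_{E∩F})` (Prop. (13.1) d) for distinct curves, tree `Lipman1969_13_1_d_rat`):
`ℓ_{κ(𝔪)}(κ(w)) = π.residueDegree w` for this `T`-structure, `ℓ_{𝒪_{X,w}}(𝒪_{X,w}/(𝓘_E + 𝓘_F)_w) =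
ord_{𝒪_{X,w}/𝔭_E}(t̄_F)` (`ExceptionalCurveIntersectionSymmetry.ordAt_pullbackRep_primeDivisor_eq`), and the
finite sum over `E ∩ F`.

## References
* W. Fulton, *Intersection Theory*, 2nd ed. (1998), App. A.1, Lemmas A.1.2–A.1.3, Ex. A.1.1. [Fulton1998]
* J. Lipman, Publ. Math. IHÉS 36 (1969), §10 (p. 212), §13 (p. 223). [Lipman1969]
-/

noncomputable section

open CategoryTheory AlgebraicGeometry TopologicalSpace IsLocalRing
open Literature.AlgebraicGeometry.Morphisms

universe u

namespace Literature.AlgebraicGeometry.Resolution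

/-! ## §1 Algebra: `R/J = R_𝔭/J R_𝔭` when `R/J` is `𝔭`-local -/

section Algebra

variable {R S : Type*} [CommRing R] [CommRing S] [Algebra R S] (P : Ideal R) [P.IsPrime]
  [IsLocalization.AtPrime S P] (J : Ideal R)

/-- **`R/J → R_𝔭/JR_𝔭` is bijective when every element outside `𝔭` is a unit modulo `J`** (i.e. `J` has
`V(J) = {𝔭}`, `𝔭` maximal; Fulton, Lemma A.1.2: a module of finite length supported at `𝔭` is its own
localisation at `𝔭`). [cite: Fulton1998, Lemma A.1.2] -/
theorem quotientMap_localization_bijective (hJ : ∀ r ∉ P, IsUnit (Ideal.Quotient.mk J r)) :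
    Function.Bijective (Ideal.quotientMap (J.map (algebraMap R S)) (algebraMap R S) Ideal.le_comap_map) := by
  constructor
  · -- injective: `algebraMap r ∈ J S` gives `t s r ∈ J` with `t s ∉ 𝔭`, a unit mod `J`
    rw [injective_iff_map_eq_zero]
    intro x hx
    obtain ⟨r, rfl⟩ := Ideal.Quotient.mk_surjective x
    rw [Ideal.quotientMap_mk, Ideal.Quotient.eq_zero_iff_mem,
      IsLocalization.mem_map_algebraMap_iff P.primeCompl] at hx
    obtain ⟨⟨⟨i, hi⟩, ⟨s, hs⟩⟩, h⟩ := hx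
    dsimp only at h
    -- `algebraMap (r * s - i) = 0`, so `t * (r * s - i) = 0` for some `t ∉ 𝔭`
    have h0 : algebraMap R S (r * s - i) = 0 := by rw [map_sub, map_mul, h, sub_self]
    obtain ⟨⟨t, ht⟩, ht0⟩ := (IsLocalization.map_eq_zero_iff P.primeCompl S _).mp h0
    dsimp only at ht0
    -- `t * s * r ≡ 0 mod J` with `t * s ∉ 𝔭`
    have hmem : t * s * r ∈ J := by
      have e : t * s * r = t * (r * s - i) + t * i := by ring
      rw [e, ht0, zero_add]
      exact J.mul_mem_left t hi
    have hts : t * s ∉ P := fun hmem' => (‹P.IsPrime›.mem_or_mem hmem').elim ht hs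
    obtain ⟨u, hu⟩ := (hJ (t * s) hts).exists_left_inv
    rw [Ideal.Quotient.eq_zero_iff_mem]
    have e2 : Ideal.Quotient.mk J r = u * Ideal.Quotient.mk J (t * s * r) := by
      rw [map_mul, ← mul_assoc, hu, one_mul]
    rw [← Ideal.Quotient.eq_zero_iff_mem, e2, Ideal.Quotient.eq_zero_iff_mem.mpr hmem, mul_zero]
  · -- surjective: `x/s ≡ x u` modulo `J S` for `u` an inverse of `s` mod `J`
    intro y
    obtain ⟨z, rfl⟩ := Ideal.Quotient.mk_surjective y
    obtain ⟨x, ⟨s, hs⟩, rfl⟩ := IsLocalization.exists_mk'_eq P.primeCompl z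
    obtain ⟨u, hu⟩ := Ideal.Quotient.mk_surjective (hJ s hs).unit⁻¹.val
    have hsu : s * u - 1 ∈ J := by
      rw [← Ideal.Quotient.eq_zero_iff_mem, map_sub, map_one, map_mul, hu, IsUnit.mul_val_inv, sub_self]
    refine ⟨Ideal.Quotient.mk J (x * u), ?_⟩
    rw [Ideal.quotientMap_mk, Ideal.Quotient.eq, map_mul]
    -- `x u - x/s = (x/s) (s u - 1)`
    have e : algebraMap R S x * algebraMap R S u - IsLocalization.mk' S x ⟨s, hs⟩ =
        IsLocalization.mk' S x ⟨s, hs⟩ * algebraMap R S (s * u - 1) := by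
      rw [map_sub, map_one, map_mul, mul_sub, mul_one, ← mul_assoc]
      have hspec : IsLocalization.mk' S x ⟨s, hs⟩ * algebraMap R S s = algebraMap R S x :=
        IsLocalization.mk'_spec S x ⟨s, hs⟩
      rw [hspec]
    rw [e]
    exact Ideal.mul_mem_left _ _ (Ideal.mem_map_of_mem _ hsu)

/-- The same bijection is `T`-linear for any `T` over which `R → S` is a map of `T`-algebras, so that
**`ℓ_T(R/J) = ℓ_T(R_𝔭/JR_𝔭)`**. [cite: Fulton1998, Lemma A.1.2] -/
theorem length_quotient_eq_length_quotient_map {T : Type*} [CommRing T] [Algebra T R] [Algebra T S]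
    [IsScalarTower T R S] (hJ : ∀ r ∉ P, IsUnit (Ideal.Quotient.mk J r)) :
    Module.length T (R ⧸ J) = Module.length T (S ⧸ J.map (algebraMap R S)) := by
  have hle : J ≤ (J.map (algebraMap R S)).comap (IsScalarTower.toAlgHom T R S) := Ideal.le_comap_map
  have hbij : Function.Bijective (Ideal.quotientMapₐ (J.map (algebraMap R S)) (IsScalarTower.toAlgHom T R S) hle) :=
    quotientMap_localization_bijective P J hJ
  exact (LinearEquiv.ofBijective (Ideal.quotientMapₐ (J.map (algebraMap R S))
    (IsScalarTower.toAlgHom T R S) hle).toLinearMap hbij).length_eq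

end Algebra

/-! ## §2 On a scheme: an ideal sheaf supported at one point `w` of an affine open `U` -/

section SchemeLocal

variable {T : Type u} [CommRing T] {X : Scheme.{u}} (π : X ⟶ Spec (.of T))

/-- For an affine open `U = Spec R` and `y ∈ Spec R`, the prime of the point `fromSpec y ∈ U` is `y`. [folklore] -/
private theorem primeIdealOf_isoSpec_inv {U : X.Opens} (hU : IsAffineOpen U) (y : Spec Γ(X, U)) :
    hU.primeIdealOf (hU.isoSpec.inv.base y) = y := by
  change (hU.isoSpec.inv ≫ hU.isoSpec.hom).base y = y
  rw [Iso.inv_hom_id]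
  rfl

/-- **If `𝓙` meets the affine open `U` only at `w`, every function on `U` not vanishing at `w` is a unit modulo
`𝓙(U)`** (a prime of `Γ(U, 𝒪)` containing `𝓙(U)` is a point of `U ∩ V(𝓙) = {w}`). [cite: Fulton1998, Lemma A.1.2] -/
theorem isUnit_quotient_mk_of_support_inter_eq (𝓙 : X.IdealSheafData) {U : X.Opens} (hU : IsAffineOpen U)
    {w : X} (hw : w ∈ U) (honly : ∀ q ∈ U, q ∈ 𝓙.support → q = w) (r : Γ(X, U))
    (hr : r ∉ (hU.primeIdealOf ⟨w, hw⟩).asIdeal) :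
    IsUnit (Ideal.Quotient.mk (𝓙.ideal ⟨U, hU⟩) r) := by
  by_contra hnu
  obtain ⟨M, hM, hrM⟩ := exists_max_ideal_of_mem_nonunits (mem_nonunits_iff.mpr hnu)
  -- the prime `M' = mk⁻¹ M ⊇ 𝓙(U)` of `Γ(U, 𝒪)` and its point `q ∈ U`
  set M' : Ideal Γ(X, U) := M.comap (Ideal.Quotient.mk (𝓙.ideal ⟨U, hU⟩)) with hM'
  haveI : M'.IsPrime := Ideal.comap_isPrime _ _
  have hJM' : 𝓙.ideal ⟨U, hU⟩ ≤ M' := fun f hf => by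
    rw [hM', Ideal.mem_comap, Ideal.Quotient.eq_zero_iff_mem.mpr hf]
    exact M.zero_mem
  have hrM' : r ∈ M' := hrM
  let y : Spec Γ(X, U) := ⟨M', inferInstance⟩
  let xU : U := hU.isoSpec.inv.base y
  -- `q = xU.1 ∈ V(𝓙)`: every `f ∈ 𝓙(U) ⊆ M'` vanishes at `q`
  have hq : xU.1 ∈ 𝓙.support := by
    rw [Scheme.IdealSheafData.mem_support_iff_of_mem (U := ⟨U, hU⟩) xU.2, Scheme.mem_zeroLocus_iff]
    intro f hf hmem
    have h1 : hU.fromSpec.base y ∈ X.basicOpen f := hmem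
    have h2 : y ∈ hU.fromSpec ⁻¹ᵁ X.basicOpen f := h1
    rw [hU.fromSpec_preimage_basicOpen] at h2
    exact (PrimeSpectrum.mem_basicOpen (R := Γ(X, U)) f y).mp h2 (hJM' hf)
  have hqw : xU.1 = w := honly _ xU.2 hq
  have hxU : xU = ⟨w, hw⟩ := Subtype.ext hqw
  have hP : hU.primeIdealOf ⟨w, hw⟩ = y := by rw [← hxU]; exact primeIdealOf_isoSpec_inv hU y
  exact hr (by rw [hP]; exact hrM')

/-- **`ℓ_T(Γ(U, 𝒪_X)/𝓙(U)) = ℓ_T(𝒪_{X,w}/𝓙_w)` for an ideal sheaf meeting the affine open `U` only at `w`**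
(`𝒪_{X,w} = Γ(U, 𝒪)_{𝔭_w}`, `𝓙_w = 𝓙(U)𝒪_{X,w}`, and `Γ(U,𝒪)/𝓙(U)` is already `𝔭_w`-local); the `T`-module
structures are those through `T → Γ(X, 𝒪_X)` (`Morphisms.Sections`, `Morphisms.algebraMapΓ`) and
`T → Γ(X, 𝒪_X) → 𝒪_{X,w}`. This is the local colength of Lipman's `h⁰` of a zero-dimensional subscheme at
the point `w` (§10 p. 212, §13 p. 223). [cite: Fulton1998, Lemma A.1.2] [cite: Lipman1969, Section 10 (p. 212)] -/
theorem length_quotient_sections_eq_length_quotient_stalk (𝓙 : X.IdealSheafData) {U : X.Opens}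
    (hU : IsAffineOpen U) {w : X} (hw : w ∈ U) (honly : ∀ q ∈ U, q ∈ 𝓙.support → q = w) :
    letI : Algebra T (X.presheaf.stalk w) := ((X.presheaf.germ ⊤ w trivial).hom.comp (algebraMapΓ π)).toAlgebra
    Module.length T (Sections π U ⧸ (𝓙.ideal ⟨U, hU⟩).comap (Sections.equiv π U).toRingHom) =
      Module.length T (X.presheaf.stalk w ⧸ stalkIdeal 𝓙 w) := by
  -- `T → Γ(U, 𝒪) → 𝒪_{X,w}`
  letI algT : Algebra T (X.presheaf.stalk w) := ((X.presheaf.germ ⊤ w trivial).hom.comp (algebraMapΓ π)).toAlgebra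
  letI algU : Algebra (Sections π U) (X.presheaf.stalk w) := (X.presheaf.germ U w hw).hom.toAlgebra
  haveI : IsScalarTower T (Sections π U) (X.presheaf.stalk w) :=
    IsScalarTower.of_algebraMap_eq fun a => by
      change (X.presheaf.germ ⊤ w trivial) (algebraMapΓ π a) =
        (X.presheaf.germ U w hw) (X.presheaf.map (homOfLE (le_top : U ≤ ⊤)).op (algebraMapΓ π a))
      rw [TopCat.Presheaf.germ_res_apply]
  haveI : IsLocalization.AtPrime (X.presheaf.stalk w)
      ((hU.primeIdealOf ⟨w, hw⟩).asIdeal.comap (Sections.equiv π U).toRingHom) :=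
    hU.isLocalization_stalk ⟨w, hw⟩
  have h := length_quotient_eq_length_quotient_map (T := T) (S := X.presheaf.stalk w)
    ((hU.primeIdealOf ⟨w, hw⟩).asIdeal.comap (Sections.equiv π U).toRingHom)
    ((𝓙.ideal ⟨U, hU⟩).comap (Sections.equiv π U).toRingHom)
    (fun r hr => isUnit_quotient_mk_of_support_inter_eq 𝓙 hU hw honly r hr)
  rw [h, stalkIdeal_eq_map_germ 𝓙 ⟨U, hU⟩ hw]
  rfl

end SchemeLocal

/-! ## §3 Over a local base: `ℓ_T(𝒪_{X,w}/I) = [κ(w) : κ(𝔪)] · ℓ_{𝒪_{X,w}}(𝒪_{X,w}/I)` (Fulton A.1.3) -/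

section LocalBase

variable {T : Type u} [CommRing T] [IsLocalRing T] {X : Scheme.{u}} (π : X ⟶ Spec (.of T))

/-- **Fulton's Lemma A.1.3 at a point over the closed point**: for `w` over the closed point of the local base
and any ideal `I ⊆ 𝒪_{X,w}`, `ℓ_T(𝒪_{X,w}/I) = ℓ_{𝒪_{X,w}}(𝒪_{X,w}/I) · [κ(w) : κ(𝔪)]`, the residue degree
being `ℓ_{κ(𝔪)}(κ(w))` for the local homomorphism `T → 𝒪_{X,w}` (Mathlib `IsLocalRing.length_restrictScalars`).
[cite: Fulton1998, Lemma A.1.3] -/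
theorem length_quotient_stalk_eq_mul {w : X} (hw : π.base w = closedPoint T) (I : Ideal (X.presheaf.stalk w)) :
    letI : Algebra T (X.presheaf.stalk w) := ((X.presheaf.germ ⊤ w trivial).hom.comp (algebraMapΓ π)).toAlgebra
    haveI : IsLocalHom (algebraMap T (X.presheaf.stalk w)) := isLocalHom_germ_algebraMapΓ π hw
    Module.length T (X.presheaf.stalk w ⧸ I) =
      Module.length (X.presheaf.stalk w) (X.presheaf.stalk w ⧸ I) *
        Module.length (ResidueField T) (ResidueField (X.presheaf.stalk w)) := by
  letI : Algebra T (X.presheaf.stalk w) := ((X.presheaf.germ ⊤ w trivial).hom.comp (algebraMapΓ π)).toAlgebra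
  haveI : IsLocalHom (algebraMap T (X.presheaf.stalk w)) := isLocalHom_germ_algebraMapΓ π hw
  exact IsLocalRing.length_restrictScalars T (X.presheaf.stalk w) (X.presheaf.stalk w ⧸ I)

/-- **The local colength at `w` of an ideal sheaf supported at one point of an affine open, over a local base**:
`ℓ_T(Γ(U, 𝒪_X)/𝓙(U)) = ℓ_{𝒪_{X,w}}(𝒪_{X,w}/𝓙_w) · [κ(w) : κ(𝔪)]` — the summand of `h⁰(𝒪_X/𝓙)`
(`Resolution/H0ZeroDimensionalSubscheme`) at `w`, in the form of Lipman §10 (p. 212: lengths over `A`) / Fulton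
Ex. A.1.1. [cite: Fulton1998, Lemma A.1.3] [cite: Lipman1969, Section 10 (p. 212)] -/
theorem length_quotient_sections_eq_mul (𝓙 : X.IdealSheafData) {U : X.Opens} (hU : IsAffineOpen U) {w : X}
    (hw : w ∈ U) (hwc : π.base w = closedPoint T) (honly : ∀ q ∈ U, q ∈ 𝓙.support → q = w) :
    letI : Algebra T (X.presheaf.stalk w) := ((X.presheaf.germ ⊤ w trivial).hom.comp (algebraMapΓ π)).toAlgebra
    haveI : IsLocalHom (algebraMap T (X.presheaf.stalk w)) := isLocalHom_germ_algebraMapΓ π hwc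
    Module.length T (Sections π U ⧸ (𝓙.ideal ⟨U, hU⟩).comap (Sections.equiv π U).toRingHom) =
      Module.length (X.presheaf.stalk w) (X.presheaf.stalk w ⧸ stalkIdeal 𝓙 w) *
        Module.length (ResidueField T) (ResidueField (X.presheaf.stalk w)) := by
  rw [length_quotient_sections_eq_length_quotient_stalk π 𝓙 hU hw honly]
  exact length_quotient_stalk_eq_mul π hwc (stalkIdeal 𝓙 w)

end LocalBase

end Literature.AlgebraicGeometry.Resolution

end
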